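import Literature.Topology.FourManifolds.CappellShanesonTotallyReal
import Literature.NumberTheory.NumberFields.CubicFieldDedekindKummer
import Mathlib.NumberTheory.NumberField.ClassNumber
import HarnessLib

/-!
# The trace `27` Cappell–Shaneson field: `𝓞 K = ℤ[ω]` with `ω = (θ² - 25θ - 3)/7`, index
# `[𝓞 K : ℤ[Θ₂₇]] = 7` (Kim–Yamada, Prop. 4.11), discriminant `7273 = 7 · 1039`, class number one

Serves the named fact
`Literature.Topology.FourManifolds.kimYamada2023_nonempty_diffeomorph_sphere_four_of_trace_mem_Icc`
(`CappellShaneson.lean`; M. H. Kim, S. Yamada, Kyungpook Math. J. 63 (2023) 373–411 =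
arXiv:1707.03860, Cor. C) through its algebraic child `KimYamada2023_thmB_traces_13_69`
(`CappellShanesonStandardOfTraceRange.lean`), for the ONE trace of Kim–Yamada's window `[13, 69]` whose
order `ℤ[Θₙ]` is NOT the maximal order: `n = 27`.  The per-trace class-group files
`CappellShanesonClassGroup<N>*.lean` all rest on `𝓞 K = ℤ[θ]`; here `Δ(f₂₇) = 356377 = 7³ · 1039` and
`ℤ[Θ₂₇]` has index `7` in `𝓞 K` (Kim–Yamada, §4.2–§4.3: "Among `3 ≤ n ≤ 75`, `n = 27` is the only case
that `C(ℤ[Θₙ])` is not a group, but a monoid").  This first file supplies the MAXIMAL ORDER of the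
trace-`27` field and its class number; the ideal classes of the order `ℤ[Θ₂₇]` itself (Kim–Yamada,
Thm. 4.17) and Theorem B for the traces `27`, `-22` follow in the sibling files.

## The number theory (all statements for a number field `K` of degree `3` with a root `θ` of `f₂₇`)

* `f₂₇ = x³ - 27x² + 26x - 1`; put `ω = (θ² - 25θ - 3)/7`.  Then `ω³ + ω² - 12ω - 7 = 0`
  (`aeval_omega_twentyseven`) and `θ = ω² + 4ω + 2` (`theta_eq_omega_twentyseven`), so `ℚ(θ) = ℚ(ω)`
  and `ℤ[θ] ⊆ ℤ[ω]`.  The cubic `g = t³ + t² - 12t - 7` is irreducible (no root mod `2`) of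
  discriminant `Δ(g) = 7273 = 7 · 1039`, squarefree; hence **`𝓞 K = ℤ[ω]`**
  (`adjoin_omegaInt_eq_top_twentyseven`) and **`d_K = 7273`** (`discr_eq_twentyseven`), by the tree's
  explicit-cubic toolkit `Literature.NumberTheory.NumberFields.MonicCubic.*` (Marcus, Ch. 2, Ex. 27).
* **Kim–Yamada, Prop. 4.11 for `k = 0`**: `η₀ = (Θ₂₇ - 2)²/7 = 7 + 13ω + 3ω²` is an algebraic integer
  which is NOT in `ℤ[Θ₂₇]` (`not_mem_adjoin_theta_twentyseven`), so `ℤ[Θ₂₇] ≠ 𝓞 K`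
  (`adjoin_thetaInt_ne_top_twentyseven`); and `7 · 𝓞 K ⊆ ℤ[Θ₂₇]` (`seven_mul_mem_adjoin_theta_twentyseven`:
  the index is exactly `7`).
* **Class number one** (`isPrincipalIdealRing_ringOfIntegers_twentyseven`): `K` is totally real
  (`CappellShanesonTotallyReal`), `⌊M_K⌋ = ⌊(2/9)√7273⌋ = 18`; Dedekind–Kummer for `ℤ[ω] = 𝓞 K`
  (Marcus, Ch. 3, Thm. 27): `2, 3` are inert; `g` has exactly one root modulo `5, 11, 13, 17`
  (`-1, -3, -2, 1`) and the degree-one primes are `(ω + 1), (ω + 3), (ω + 2), (ω - 1)` of norms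
  `-5, -11, -13, 17`; and `7 = ω (ω - 3) (ω + 4)` with three factors of norm `7` (`7 𝓞 K = 𝔭𝔮²`,
  `𝔮 = (ω - 3) = (ω + 4)`), so every prime above `p ≤ 18` is principal.
* Coordinates: every algebraic integer is `a + bω + cω²` with `a, b, c ∈ ℤ`
  (`exists_int_coords_twentyseven`), for the sibling files.

Everything is PROVED (no `def`, no named fact; D-0026).  The numerical data (integral basis, `h_K = 1`,
prime decomposition) were certified independently with PARI/GP (`bnfcertify`).

## References

* [KimYamada2023] M. H. Kim, S. Yamada, *Ideal classes and Cappell–Shaneson homotopy 4-spheres*,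
  Kyungpook Math. J. 63 (2023) 373–411 (arXiv:1707.03860): §4.2 Prop. 4.10, Prop. 4.11 (`η_k =
  (Θ_{49k+27} - 2)²/7` is integral, `ℤ[Θ_{49k+27}]` is not integrally closed), §4.3 (the trace `27`),
  §6.1 (proof of Thm. B).
* [Marcus2018] D. A. Marcus, *Number Fields*, 2nd ed. (2018): Ch. 2, Exercise 27 (discriminant and index);
  Ch. 3, Thm. 27 (Dedekind–Kummer); Ch. 5, Cor. 2 of Thm. 37 (Minkowski bound).
* [AitchisonRubinstein1984] I. R. Aitchison, J. H. Rubinstein, *Fibered knots and involutions on homotopy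
  spheres*, Contemp. Math. 35 (1984), Appendix, Table 1 (column "`R = R'?`").
-/

noncomputable section

open Polynomial Module NumberField Ideal
open scoped NumberField

namespace Literature.Topology.FourManifolds

open Literature.NumberTheory.NumberFields

section Field

variable {K : Type*} [Field K] [NumberField K] {θ : K}

/-! ### The cubic relation and the generator `ω = (θ² - 25θ - 3)/7` of the maximal order -/

omit [NumberField K] in
/-- The relation `θ³ = 27θ² - 26θ + 1` of a root of `f₂₇ = x³ - 27x² + 26x - 1`.
[cite: KimYamada2023, §4.3 (f₂₇(x) = x³ - 27x² + 26x - 1)] -/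
theorem theta_rel_twentyseven (hθ : aeval θ (csPoly 27) = 0) :
    θ ^ 3 - 27 * θ ^ 2 + 26 * θ - 1 = 0 := by
  have h := hθ
  simp only [csPoly, map_sub, map_add, map_mul, map_pow, aeval_X, map_one, eq_intCast,
    map_intCast] at h
  push_cast at h
  linear_combination h

/-- **`ω = (θ² - 25θ - 3)/7` is a root of `g = t³ + t² - 12t - 7`.**  (`343 · g(ω) =
f₂₇(θ) · (θ³ - 48θ² + 551θ + 601)`.)  This `ω` differs from Kim–Yamada's `η₀ = (θ - 2)²/7` by
`η₀ = 7 + 13ω + 3ω²` (`omega0_eq_twentyseven`). [cite: KimYamada2023, §4.2 Prop. 4.11 (proof)] -/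
theorem aeval_omega_twentyseven (hθ : aeval θ (csPoly 27) = 0) :
    aeval ((θ ^ 2 - 25 * θ - 3) / 7) (MonicCubic.poly 1 (-12) (-7)) = 0 := by
  have hrel := theta_rel_twentyseven hθ
  have h7 : (7 : K) ≠ 0 := by norm_num
  set η : K := (θ ^ 2 - 25 * θ - 3) / 7 with hη
  have hη7 : 7 * η = θ ^ 2 - 25 * θ - 3 := by rw [hη]; field_simp
  have key : (343 : K) * (η ^ 3 + η ^ 2 - 12 * η - 7) = 0 := by
    have : (343 : K) * (η ^ 3 + η ^ 2 - 12 * η - 7) =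
        (7 * η) ^ 3 + 7 * (7 * η) ^ 2 - 588 * (7 * η) - 2401 := by ring
    rw [this, hη7]
    linear_combination (θ ^ 3 - 48 * θ ^ 2 + 551 * θ + 601) * hrel
  have h343 : (343 : K) ≠ 0 := by norm_num
  have key' : η ^ 3 + η ^ 2 - 12 * η - 7 = 0 := by
    rcases mul_eq_zero.mp key with h | h
    · exact absurd h h343
    · exact h
  simp only [MonicCubic.poly, map_add, map_mul, map_pow, aeval_X, eq_intCast, map_intCast]
  push_cast
  linear_combination key'

/-- **`θ = ω² + 4ω + 2`**: the root of `f₂₇` is an integer polynomial in `ω`, so `ℤ[Θ₂₇] ⊆ ℤ[ω]`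
(`49 (ω² + 4ω + 2 - θ) = f₂₇(θ) (θ - 23)`). [cite: KimYamada2023, §4.2 Prop. 4.11 (proof)] -/
theorem theta_eq_omega_twentyseven (hθ : aeval θ (csPoly 27) = 0) :
    θ = ((θ ^ 2 - 25 * θ - 3) / 7) ^ 2 + 4 * ((θ ^ 2 - 25 * θ - 3) / 7) + 2 := by
  have hrel := theta_rel_twentyseven hθ
  set η : K := (θ ^ 2 - 25 * θ - 3) / 7 with hη
  have hη7 : 7 * η = θ ^ 2 - 25 * θ - 3 := by rw [hη]; field_simp
  have key : (49 : K) * (η ^ 2 + 4 * η + 2 - θ) = 0 := by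
    have : (49 : K) * (η ^ 2 + 4 * η + 2 - θ) = (7 * η) ^ 2 + 28 * (7 * η) + 98 - 49 * θ := by ring
    rw [this, hη7]
    linear_combination (θ - 23) * hrel
  have h49 : (49 : K) ≠ 0 := by norm_num
  rcases mul_eq_zero.mp key with h | h
  · exact absurd h h49
  · linear_combination (-1 : K) * h

/-- **Kim–Yamada's `η₀ = (Θ₂₇ - 2)²/7` in terms of `ω`: `η₀ = 7 + 13ω + 3ω²`.**
[cite: KimYamada2023, §4.2 Prop. 4.11] -/
theorem omega0_eq_twentyseven (hθ : aeval θ (csPoly 27) = 0) :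
    (θ - 2) ^ 2 / 7 = 7 + 13 * ((θ ^ 2 - 25 * θ - 3) / 7) + 3 * ((θ ^ 2 - 25 * θ - 3) / 7) ^ 2 := by
  have hrel := theta_rel_twentyseven hθ
  set η : K := (θ ^ 2 - 25 * θ - 3) / 7 with hη
  have hη7 : 7 * η = θ ^ 2 - 25 * θ - 3 := by rw [hη]; field_simp
  have key : (49 : K) * ((θ - 2) ^ 2 / 7 - (7 + 13 * η + 3 * η ^ 2)) = 0 := by
    have : (49 : K) * ((θ - 2) ^ 2 / 7 - (7 + 13 * η + 3 * η ^ 2)) =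
        7 * (θ - 2) ^ 2 - 343 - 91 * (7 * η) - 3 * (7 * η) ^ 2 := by
      ring
    rw [this, hη7]
    linear_combination (69 - 3 * θ) * hrel
  have h49 : (49 : K) ≠ 0 := by norm_num
  rcases mul_eq_zero.mp key with h | h
  · exact absurd h h49
  · linear_combination h

/-! ### `g = t³ + t² - 12t - 7`: irreducible, discriminant `7273 = 7 · 1039` squarefree -/

/-- `g = t³ + t² - 12t - 7` has no root modulo `2`, hence is irreducible over `ℚ` (reduction and Gauss's
lemma). [cite: Marcus2018, Ch. 3, Thm. 27] -/
theorem irreducible_polyQ_twentyseven : Irreducible (MonicCubic.polyQ 1 (-12) (-7)) :=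
  MonicCubic.irreducible_polyQ_of_no_root 2 (by decide)

/-- `Δ(g) = 7273` (`= 7 · 1039 = d_K`, the discriminant `Δ(f₂₇) = 356377 = 7³ · 1039` divided by the
index squared `7²`). [cite: KimYamada2023, §4.3 (Δ(f₂₇) = 356377 = 7³ · 1039)] -/
theorem disc_twentyseven : MonicCubic.disc 1 (-12) (-7) = 7273 := by
  norm_num [MonicCubic.disc]

/-- `7273 = 7 · 1039` is squarefree: no factorisation `7273 = r² e` with `|e| > 2` and `r ≠ ±1`
(the arithmetic input of Marcus, Ex. 2.27(e)). [cite: Marcus2018, Ch. 2, Exercise 27] -/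
theorem disc_twentyseven_sq :
    ∀ r e : ℤ, MonicCubic.disc 1 (-12) (-7) = r ^ 2 * e → 2 < |e| → IsUnit r := by
  rw [disc_twentyseven]
  exact isUnit_of_eq_sq_mul (B := 85) (by decide) (by decide) (by decide)

/-! ### `𝓞 K = ℤ[ω]`, `d_K = 7273`, coordinates -/

/-- **`𝓞 K = ℤ[ω]`**: the ring of integers of the trace-`27` Cappell–Shaneson field is generated by
`ω = (θ² - 25θ - 3)/7` (`Δ(g) = 7273` squarefree; Marcus, Ex. 2.27).
[cite: Marcus2018, Ch. 2, Exercise 27] [cite: KimYamada2023, §4.2 Prop. 4.11 and §4.3] -/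
theorem adjoin_omegaInt_eq_top_twentyseven (hθ : aeval θ (csPoly 27) = 0) (h3 : finrank ℚ K = 3) :
    Algebra.adjoin ℤ ({MonicCubic.thetaInt (aeval_omega_twentyseven hθ)} : Set (𝓞 K)) = ⊤ :=
  MonicCubic.adjoin_thetaInt_eq_top irreducible_polyQ_twentyseven (aeval_omega_twentyseven hθ) h3
    disc_twentyseven_sq

/-- Every algebraic integer of `K` lies in `ℤ[ω]` (inside `K`). [cite: Marcus2018, Ch. 2, Exercise 27] -/
theorem mem_adjoin_omega_twentyseven (hθ : aeval θ (csPoly 27) = 0) (h3 : finrank ℚ K = 3)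
    (x : 𝓞 K) : (x : K) ∈ Algebra.adjoin ℤ ({(θ ^ 2 - 25 * θ - 3) / 7} : Set K) :=
  MonicCubic.mem_adjoin_theta irreducible_polyQ_twentyseven (aeval_omega_twentyseven hθ) h3
    disc_twentyseven_sq x

/-- **`d_K = 7273`** for the trace-`27` Cappell–Shaneson field (`= 7 · 1039`; `Δ(f₂₇) = 7² · d_K`).
[cite: KimYamada2023, §4.3] [cite: Marcus2018, Ch. 2, Exercise 27] -/
theorem discr_eq_twentyseven (hθ : aeval θ (csPoly 27) = 0) (h3 : finrank ℚ K = 3) :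
    NumberField.discr K = 7273 := by
  rw [MonicCubic.discr_eq_disc irreducible_polyQ_twentyseven (aeval_omega_twentyseven hθ) h3
    disc_twentyseven_sq, disc_twentyseven]

/-- The cubic relation `ω³ = -ω² + 12ω + 7` in `𝓞 K` (`g(ω) = 0`). [cite: KimYamada2023, §4.2 Prop. 4.11 (proof)] -/
theorem omegaInt_rel_twentyseven (hθ : aeval θ (csPoly 27) = 0) :
    (MonicCubic.thetaInt (aeval_omega_twentyseven hθ)) ^ 3 =
      -(MonicCubic.thetaInt (aeval_omega_twentyseven hθ)) ^ 2 +
        12 * MonicCubic.thetaInt (aeval_omega_twentyseven hθ) + 7 := by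
  have h := MonicCubic.thetaInt_rel (aeval_omega_twentyseven hθ)
  push_cast at h
  linear_combination h

/-- **Integral coordinates: every algebraic integer of `K` is `a + bω + cω²`, `a, b, c ∈ ℤ`.**
[cite: Marcus2018, Ch. 2, Exercise 27] -/
theorem exists_int_coords_twentyseven (hθ : aeval θ (csPoly 27) = 0) (h3 : finrank ℚ K = 3)
    (x : 𝓞 K) :
    ∃ a b c : ℤ, x = a + b * MonicCubic.thetaInt (aeval_omega_twentyseven hθ) +
      c * (MonicCubic.thetaInt (aeval_omega_twentyseven hθ)) ^ 2 := by
  set w := MonicCubic.thetaInt (aeval_omega_twentyseven hθ) with hw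
  have hx : x ∈ Algebra.adjoin ℤ ({w} : Set (𝓞 K)) := by
    rw [adjoin_omegaInt_eq_top_twentyseven hθ h3]; exact Algebra.mem_top
  rw [Algebra.adjoin_singleton_eq_range_aeval] at hx
  obtain ⟨p, hp⟩ := hx
  have hmonic : (MonicCubic.poly 1 (-12) (-7)).Monic := MonicCubic.monic_poly 1 (-12) (-7)
  set r := p %ₘ MonicCubic.poly 1 (-12) (-7) with hr
  have hpr : aeval w p = aeval w r := by
    have hdiv := Polynomial.modByMonic_add_div p (MonicCubic.poly 1 (-12) (-7))
    conv_lhs => rw [← hdiv]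
    rw [map_add, map_mul, MonicCubic.aeval_thetaInt, zero_mul, add_zero]
  have hdeg : r.natDegree < 3 := by
    have hne : MonicCubic.poly 1 (-12) (-7) ≠ 1 := by
      intro h
      have := congrArg Polynomial.natDegree h
      rw [MonicCubic.natDegree_poly, natDegree_one] at this
      exact absurd this (by norm_num)
    have := Polynomial.natDegree_modByMonic_lt p hmonic hne
    rwa [MonicCubic.natDegree_poly] at this
  have hsum := Polynomial.as_sum_range' r 3 hdeg
  refine ⟨r.coeff 0, r.coeff 1, r.coeff 2, ?_⟩
  change (aeval w) p = x at hp
  rw [← hp, hpr]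
  conv_lhs => rw [hsum]
  simp [Finset.sum_range_succ]

/-! ### Kim–Yamada, Prop. 4.11 (`k = 0`): `(Θ₂₇ - 2)²/7` is integral but not in `ℤ[Θ₂₇]`; index `7` -/

/-- **`η₀ = (Θ₂₇ - 2)²/7` is an algebraic integer** («`η_k ∈ 𝒪_{49k+27}`», here `k = 0`).
[cite: KimYamada2023, §4.2 Prop. 4.11] -/
theorem isIntegral_omega0_twentyseven (hθ : aeval θ (csPoly 27) = 0) :
    IsIntegral ℤ ((θ - 2) ^ 2 / 7 : K) := by
  set w := MonicCubic.thetaInt (aeval_omega_twentyseven hθ) with hw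
  have h : ((7 + 13 * w + 3 * w ^ 2 : 𝓞 K) : K) =
      7 + 13 * ((θ ^ 2 - 25 * θ - 3) / 7) + 3 * ((θ ^ 2 - 25 * θ - 3) / 7) ^ 2 := by
    simp [hw, MonicCubic.thetaInt, RingOfIntegers.coe_eq_algebraMap, map_ofNat]
  rw [omega0_eq_twentyseven hθ, ← h]
  exact RingOfIntegers.isIntegral_coe _

omit [NumberField K] in
/-- An element of `ℤ[θ]` is `c₀ + c₁θ + c₂θ²` with integer coefficients (reduction modulo the monic
cubic `f₂₇`: «`ℤ[α]` has a free `ℤ`-basis `1, α, …, αⁿ⁻¹`»). [cite: KimYamada2023, §4 Example 4.2] -/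
theorem exists_int_coords_of_mem_adjoin_theta_twentyseven (hθ : aeval θ (csPoly 27) = 0) {x : K}
    (hx : x ∈ Algebra.adjoin ℤ ({θ} : Set K)) :
    ∃ c₀ c₁ c₂ : ℤ, x = c₀ + c₁ * θ + c₂ * θ ^ 2 := by
  rw [Algebra.adjoin_singleton_eq_range_aeval] at hx
  obtain ⟨p, hp⟩ := hx
  have hmonic : (csPoly 27).Monic := monic_csPoly 27
  set r := p %ₘ csPoly 27 with hr
  have hpr : aeval θ p = aeval θ r := by
    have hdiv := Polynomial.modByMonic_add_div p (csPoly 27)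
    conv_lhs => rw [← hdiv]
    rw [map_add, map_mul, hθ, zero_mul, add_zero]
  have hdeg : r.natDegree < 3 := by
    have hne : csPoly 27 ≠ 1 := by
      intro h
      have := congrArg Polynomial.natDegree h
      rw [natDegree_csPoly, natDegree_one] at this
      exact absurd this (by norm_num)
    have := Polynomial.natDegree_modByMonic_lt p hmonic hne
    rwa [natDegree_csPoly] at this
  have hsum := Polynomial.as_sum_range' r 3 hdeg
  refine ⟨r.coeff 0, r.coeff 1, r.coeff 2, ?_⟩
  change (aeval θ) p = x at hp
  rw [← hp, hpr]
  conv_lhs => rw [hsum]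
  simp [Finset.sum_range_succ]

/-- A rational quadratic relation `c₀ + c₁θ + c₂θ² = 0` forces `c₂ = 0` (the minimal polynomial of
`θ` has degree `3`: `f₂₇` is irreducible). [cite: KimYamada2023, §4 Example 4.2 and Thm. 2.13 (fₙ irreducible)] -/
theorem coeff_two_eq_zero_of_quadratic_twentyseven (hθ : aeval θ (csPoly 27) = 0) {c₀ c₁ c₂ : ℚ}
    (h : (c₀ : K) + (c₁ : K) * θ + (c₂ : K) * θ ^ 2 = 0) : c₂ = 0 := by
  by_contra hc
  set q : ℚ[X] := C c₀ + C c₁ * X + C c₂ * X ^ 2 with hq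
  have hq0 : q ≠ 0 := by
    intro h0
    have := congrArg (fun p : ℚ[X] => p.coeff 2) h0
    simp [hq] at this
    exact hc this
  have haev : aeval θ q = 0 := by
    simp only [hq, map_add, map_mul, map_pow, aeval_C, aeval_X, eq_ratCast]
    simpa using h
  have hdeg := minpoly.degree_le_of_ne_zero ℚ θ hq0 haev
  rw [minpoly_rat_eq hθ, Polynomial.degree_eq_natDegree (monic_csPolyQ 27).ne_zero,
    natDegree_csPolyQ, Polynomial.degree_eq_natDegree hq0, Nat.cast_le] at hdeg
  have hle : q.natDegree ≤ 2 := by rw [hq]; compute_degree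
  omega

/-- **Kim–Yamada, Prop. 4.11 (`k = 0`): `η₀ = (Θ₂₇ - 2)²/7 ∉ ℤ[Θ₂₇]`** — so `ℤ[Θ₂₇]` is a proper
subring of the ring of integers, i.e. NOT integrally closed, and `C(ℤ[Θ₂₇])` is not a group («Since
`η_k ∉ ℤ[Θ_{49k+27}]`, this completes the proof that `ℤ[Θ_{49k+27}]` is not equal to `𝒪_{49k+27}`»).
[cite: KimYamada2023, §4.2 Prop. 4.11 and Prop. 4.10] -/
theorem not_mem_adjoin_theta_twentyseven (hθ : aeval θ (csPoly 27) = 0) :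
    ((θ - 2) ^ 2 / 7 : K) ∉ Algebra.adjoin ℤ ({θ} : Set K) := by
  intro hmem
  obtain ⟨c₀, c₁, c₂, hc⟩ := exists_int_coords_of_mem_adjoin_theta_twentyseven hθ hmem
  -- `θ² - 4θ + 4 = 7c₀ + 7c₁θ + 7c₂θ²`, so `(1 - 7c₂)θ² + … = 0`, forcing `7c₂ = 1`.
  have h7 : (7 : K) ≠ 0 := by norm_num
  have hrel : (((4 - 7 * c₀ : ℚ)) : K) + ((-4 - 7 * c₁ : ℚ) : K) * θ + ((1 - 7 * c₂ : ℚ) : K) * θ ^ 2 = 0 := by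
    have hc' : (θ - 2) ^ 2 = 7 * (c₀ + c₁ * θ + c₂ * θ ^ 2) := by
      rw [← hc]; field_simp
    push_cast
    linear_combination hc'
  have h := coeff_two_eq_zero_of_quadratic_twentyseven hθ hrel
  have h' : (7 : ℚ) * c₂ = 1 := by linarith
  have h'' : (7 : ℤ) * c₂ = 1 := by exact_mod_cast h'
  omega

/-- **`ℤ[Θ₂₇] ≠ 𝓞 K`** inside `𝓞 K`: the subring generated by `θ` is not everything (it misses `η₀`).
[cite: KimYamada2023, §4.2 Prop. 4.11] -/
theorem adjoin_thetaInt_ne_top_twentyseven (hθ : aeval θ (csPoly 27) = 0) :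
    Algebra.adjoin ℤ ({thetaInt hθ} : Set (𝓞 K)) ≠ ⊤ := by
  intro htop
  set w : 𝓞 K := ⟨(θ - 2) ^ 2 / 7, isIntegral_omega0_twentyseven hθ⟩ with hw
  have hmem : w ∈ Algebra.adjoin ℤ ({thetaInt hθ} : Set (𝓞 K)) := by rw [htop]; exact Algebra.mem_top
  rw [Algebra.adjoin_singleton_eq_range_aeval] at hmem
  obtain ⟨p, hp⟩ := hmem
  apply not_mem_adjoin_theta_twentyseven hθ
  rw [Algebra.adjoin_singleton_eq_range_aeval]
  refine ⟨p, ?_⟩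
  change aeval θ p = (θ - 2) ^ 2 / 7
  change aeval (thetaInt hθ) p = w at hp
  have := congrArg (algebraMap (𝓞 K) K) hp
  rw [← aeval_algebraMap_apply] at this
  exact this

/-- `7ω² = -4θ² + 107θ - 2` (so `7ω, 7ω² ∈ ℤ[θ]`: the index of `ℤ[Θ₂₇]` in `ℤ[ω]` divides `7`).
[cite: KimYamada2023, §4.3 (Δ(f₂₇) = 7³ · 1039)] -/
theorem seven_mul_omega_sq_twentyseven (hθ : aeval θ (csPoly 27) = 0) :
    7 * ((θ ^ 2 - 25 * θ - 3) / 7) ^ 2 = -4 * θ ^ 2 + 107 * θ - 2 := by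
  have hrel := theta_rel_twentyseven hθ
  set η : K := (θ ^ 2 - 25 * θ - 3) / 7 with hη
  have hη7 : 7 * η = θ ^ 2 - 25 * θ - 3 := by rw [hη]; field_simp
  have key : (7 : K) * (7 * η ^ 2 - (-4 * θ ^ 2 + 107 * θ - 2)) = 0 := by
    have : (7 : K) * (7 * η ^ 2 - (-4 * θ ^ 2 + 107 * θ - 2)) =
        (7 * η) ^ 2 - 7 * (-4 * θ ^ 2 + 107 * θ - 2) := by ring
    rw [this, hη7]
    linear_combination (θ - 23) * hrel
  have h7 : (7 : K) ≠ 0 := by norm_num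
  rcases mul_eq_zero.mp key with h | h
  · exact absurd h h7
  · linear_combination h

/-- **`7 · 𝓞 K ⊆ ℤ[Θ₂₇]`**: the index of `ℤ[Θ₂₇]` in the maximal order divides `7` (with
`not_mem_adjoin_theta_twentyseven`: it IS `7`; `Δ(f₂₇) = 7² · d_K`). [cite: KimYamada2023, §4.3 (Δ(f₂₇) = 7³ · 1039)]
[cite: Marcus2018, Ch. 2, Exercise 27] -/
theorem seven_mul_mem_adjoin_theta_twentyseven (hθ : aeval θ (csPoly 27) = 0) (h3 : finrank ℚ K = 3)
    (x : 𝓞 K) : 7 * (x : K) ∈ Algebra.adjoin ℤ ({θ} : Set K) := by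
  obtain ⟨a, b, c, habc⟩ := exists_int_coords_twentyseven hθ h3 x
  have hx : (x : K) = a + b * ((θ ^ 2 - 25 * θ - 3) / 7) + c * ((θ ^ 2 - 25 * θ - 3) / 7) ^ 2 := by
    rw [habc]
    simp [MonicCubic.thetaInt, RingOfIntegers.coe_eq_algebraMap]
  have h7sq := seven_mul_omega_sq_twentyseven hθ
  have hθmem : θ ∈ Algebra.adjoin ℤ ({θ} : Set K) := Algebra.self_mem_adjoin_singleton ℤ θ
  have heq : 7 * (x : K) = (7 * a - 3 * b - 2 * c : ℤ) + ((-25) * b + 107 * c : ℤ) * θ +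
      (b - 4 * c : ℤ) * θ ^ 2 := by
    rw [hx]
    push_cast
    linear_combination (c : K) * h7sq
  rw [heq]
  refine Subalgebra.add_mem _ (Subalgebra.add_mem _ ?_ ?_) ?_
  · exact Subalgebra.intCast_mem _ _
  · exact Subalgebra.mul_mem _ (Subalgebra.intCast_mem _ _) hθmem
  · exact Subalgebra.mul_mem _ (Subalgebra.intCast_mem _ _) (Subalgebra.pow_mem _ hθmem 2)

/-! ### The primes above `p ≤ 18` and class number one -/

/-- Norms of the elements `k + ω` (`k ∈ ℤ`): `|N(k + ω)| = |g(-k)| = |k³ - k² - 12k + 7|` (the norm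
form of `g`). [cite: Marcus2018, Ch. 2, Thm. 4 and Exercise 13] -/
theorem natAbs_norm_omegaInt_add_twentyseven (hθ : aeval θ (csPoly 27) = 0) (h3 : finrank ℚ K = 3)
    (k : ℤ) :
    (Algebra.norm ℤ ((k : 𝓞 K) + MonicCubic.thetaInt (aeval_omega_twentyseven hθ))).natAbs =
      (k ^ 3 - k ^ 2 - 12 * k + 7).natAbs := by
  have h := Algebra.coe_norm_int ((k : 𝓞 K) + MonicCubic.thetaInt (aeval_omega_twentyseven hθ))
  have hx : (((k : 𝓞 K) + MonicCubic.thetaInt (aeval_omega_twentyseven hθ) : 𝓞 K) : K) =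
      ((k : ℚ) : K) + ((1 : ℚ) : K) * ((θ ^ 2 - 25 * θ - 3) / 7) +
        ((0 : ℚ) : K) * ((θ ^ 2 - 25 * θ - 3) / 7) ^ 2 := by
    simp [MonicCubic.thetaInt, RingOfIntegers.coe_eq_algebraMap]
  rw [hx, MonicCubic.norm_lin irreducible_polyQ_twentyseven (aeval_omega_twentyseven hθ) h3] at h
  have h' : Algebra.norm ℤ ((k : 𝓞 K) + MonicCubic.thetaInt (aeval_omega_twentyseven hθ)) =
      k ^ 3 - k ^ 2 - 12 * k + 7 := by
    have : (MonicCubic.normForm 1 (-12) (-7) (k : ℚ) 1 0) = ((k ^ 3 - k ^ 2 - 12 * k + 7 : ℤ) : ℚ) := by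
      push_cast; simp only [MonicCubic.normForm]; push_cast; ring
    rw [this] at h
    exact_mod_cast h
  rw [h']

/-- `ω`, `ω - 3`, `ω + 4` are prime elements of `𝓞 K` (norm `7` each). [cite: Marcus2018, Ch. 3, Thm. 27] -/
theorem prime_omegaInt_add_twentyseven (hθ : aeval θ (csPoly 27) = 0) (h3 : finrank ℚ K = 3)
    {k : ℤ} (hk : k = 0 ∨ k = -3 ∨ k = 4) :
    Prime ((k : 𝓞 K) + MonicCubic.thetaInt (aeval_omega_twentyseven hθ)) := by
  refine MonicCubic.prime_of_natAbs_norm_prime ?_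
  rw [natAbs_norm_omegaInt_add_twentyseven hθ h3]
  rcases hk with rfl | rfl | rfl <;> norm_num

/-- **`7 = ω (ω - 3) (ω + 4)`** in `𝓞 K` (`g(t) = t(t - 3)(t + 4) - 7`): `7 𝓞 K = 𝔭 𝔮²` with
`𝔭 = (ω)`, `𝔮 = (ω - 3) = (ω + 4)` of norm `7`. [cite: KimYamada2023, §4.3 (f₂₇ ≡ (x-2)³ mod 7, Δ = 7³·1039)]
[cite: Marcus2018, Ch. 3, Thm. 27] -/
theorem seven_eq_prod_twentyseven (hθ : aeval θ (csPoly 27) = 0) :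
    (7 : 𝓞 K) = (((0 : ℤ) : 𝓞 K) + MonicCubic.thetaInt (aeval_omega_twentyseven hθ)) *
      (((-3 : ℤ) : 𝓞 K) + MonicCubic.thetaInt (aeval_omega_twentyseven hθ)) *
        (((4 : ℤ) : 𝓞 K) + MonicCubic.thetaInt (aeval_omega_twentyseven hθ)) := by
  have hrel := omegaInt_rel_twentyseven hθ
  push_cast
  linear_combination -hrel

set_option maxHeartbeats 800000 in
/-- **Class number one for the trace-`27` Cappell–Shaneson field: `𝓞 K = ℤ[ω]` is a principal ideal
domain.**  Minkowski: `K` is totally real with `d_K = 7273`, `⌊(2/9)√7273⌋ = 18`; Dedekind–Kummer for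
`g = t³ + t² - 12t - 7`: `2, 3` inert; unique roots `-1, -3, -2, 1` modulo `5, 11, 13, 17` with the
degree-one primes `(ω + 1), (ω + 3), (ω + 2), (ω - 1)` (norms `-5, -11, -13, 17`; the degree-two primes
have norm `p² > 18`); `7 = ω(ω - 3)(ω + 4)` with prime factors of norm `7`.  (Kim–Yamada compute
`Pic(ℤ[Θ₂₇]) ≅ ℤ/6` by MAGMA, §4.4; the class number `h_K = 1` of the MAXIMAL order is its quotient by
`(𝓞_K/𝔣)^*/(ℤ[Θ₂₇]/𝔣)^* ≅ 𝔽₇^*`.) [cite: KimYamada2023, §4.3–§4.4 and §6.1 (proof of Thm. B)]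
[cite: Marcus2018, Ch. 3, Thm. 27; Ch. 5, Cor. 2 of Thm. 37] -/
theorem isPrincipalIdealRing_ringOfIntegers_twentyseven (hθ : aeval θ (csPoly 27) = 0)
    (h3 : finrank ℚ K = 3) : IsPrincipalIdealRing (𝓞 K) := by
  have hη := aeval_omega_twentyseven hθ
  have hirr := irreducible_polyQ_twentyseven
  have hsq := disc_twentyseven_sq
  have rel := omegaInt_rel_twentyseven hθ
  set w := MonicCubic.thetaInt hη with hw
  have hd : ((|NumberField.discr K| : ℤ) : ℝ) ≤ (7273 : ℕ) := by
    rw [discr_eq_twentyseven hθ h3]; norm_num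
  have h0 := nrComplexPlaces_eq_zero_of_csPoly hθ h3 (by norm_num)
  have hfloor := floor_minkowskiBound_le_cubic_real h3 h0 hd (s := 85.3) (U := 18) (by norm_num)
    (by norm_num) (by norm_num)
  refine RingOfIntegers.isPrincipalIdealRing_of_isPrincipal_of_pow_le_of_mem_primesOver_of_mem_Icc
    fun p hp hprime P hP hle => ?_
  have hpU : p ≤ 18 := (Finset.mem_Icc.mp hp).2.trans hfloor
  have hle' : p ^ P.inertiaDeg ℤ ≤ 18 := hle.trans hfloor
  have h1p : 1 ≤ p := (Finset.mem_Icc.mp hp).1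
  have principal_of_eq : ∀ {x : 𝓞 K}, P = span {x} → Submodule.IsPrincipal P := fun h =>
    ⟨⟨_, by rw [h, submodule_span_eq]⟩⟩
  haveI := hP.1
  interval_cases p
  · exfalso; revert hprime; decide
  · -- `p = 2`: inert
    exact principal_of_eq (MonicCubic.eq_span_of_no_root hirr hη h3 hsq hprime hP (by decide))
  · -- `p = 3`: inert
    exact principal_of_eq (MonicCubic.eq_span_of_no_root hirr hη h3 hsq hprime hP (by decide))
  · exfalso; revert hprime; decide
  · -- `p = 5`: unique root `-1`, `(5, ω + 1) = (ω + 1)`, `5 = (ω + 1)(12 - ω²)`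
    exact MonicCubic.isPrincipal_of_unique_root hirr hη h3 hsq hprime hP hle' (r₀ := -1) (by decide)
      (by norm_num) (α := w + 1)
      (span_pair_eq_span_singleton (u := 0) (v := 1) (δ := 12 - w ^ 2) (ε := 1)
        (by push_cast; ring) (by linear_combination (1 : 𝓞 K) * rel) (by push_cast; ring))
  · exfalso; revert hprime; decide
  · -- `p = 7`: `7 = ω (ω - 3) (ω + 4)`, three prime elements of norm `7`
    have hmem : (((0 : ℤ) : 𝓞 K) + w) * ((((-3 : ℤ) : 𝓞 K)) + w) * ((((4 : ℤ) : 𝓞 K)) + w) ∈ P := by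
      rw [← seven_eq_prod_twentyseven hθ]
      have h7 : (((7 : ℕ) : ℤ) : 𝓞 K) ∈ P := by
        have hu : ((7 : ℕ) : ℤ) ∈ P.under ℤ := by
          rw [← hP.2.over]; exact Ideal.mem_span_singleton_self _
        exact hu
      simpa using h7
    rcases MonicCubic.eq_span_singleton_of_prod_mem hP.1
        (prime_omegaInt_add_twentyseven hθ h3 (Or.inl rfl))
        (prime_omegaInt_add_twentyseven hθ h3 (Or.inr (Or.inl rfl)))
        (prime_omegaInt_add_twentyseven hθ h3 (Or.inr (Or.inr rfl))) hmem with h | h | h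
    · exact principal_of_eq h
    · exact principal_of_eq h
    · exact principal_of_eq h
  · exfalso; revert hprime; decide
  · exfalso; revert hprime; decide
  · exfalso; revert hprime; decide
  · -- `p = 11`: unique root `-3`, `(11, ω + 3) = (ω + 3)`, `11 = (ω + 3)(6 + 2ω - ω²)`
    exact MonicCubic.isPrincipal_of_unique_root hirr hη h3 hsq hprime hP hle' (r₀ := -3) (by decide)
      (by norm_num) (α := w + 3)
      (span_pair_eq_span_singleton (u := 0) (v := 1) (δ := 6 + 2 * w - w ^ 2) (ε := 1)
        (by push_cast; ring) (by linear_combination (1 : 𝓞 K) * rel) (by push_cast; ring))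
  · exfalso; revert hprime; decide
  · -- `p = 13`: unique root `-2`, `(13, ω + 2) = (ω + 2)`, `13 = (ω + 2)(10 + ω - ω²)`
    exact MonicCubic.isPrincipal_of_unique_root hirr hη h3 hsq hprime hP hle' (r₀ := -2) (by decide)
      (by norm_num) (α := w + 2)
      (span_pair_eq_span_singleton (u := 0) (v := 1) (δ := 10 + w - w ^ 2) (ε := 1)
        (by push_cast; ring) (by linear_combination (1 : 𝓞 K) * rel) (by push_cast; ring))
  · exfalso; revert hprime; decide
  · exfalso; revert hprime; decide
  · exfalso; revert hprime; decide
  · -- `p = 17`: unique root `1`, `(17, ω - 1) = (ω - 1)`, `17 = (ω - 1)(ω² + 2ω - 10)`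
    exact MonicCubic.isPrincipal_of_unique_root hirr hη h3 hsq hprime hP hle' (r₀ := 1) (by decide)
      (by norm_num) (α := w - 1)
      (span_pair_eq_span_singleton (u := 0) (v := 1) (δ := w ^ 2 + 2 * w - 10) (ε := 1)
        (by push_cast; ring) (by linear_combination (-1 : 𝓞 K) * rel) (by push_cast; ring))
  · exfalso; revert hprime; decide

/-- **Every ideal of `𝓞 K` is principal** (class number one of the trace-`27` field), in the form used by
the sibling file on the ideal classes of `ℤ[Θ₂₇]`. [cite: KimYamada2023, §4.3–§4.4] -/
theorem exists_eq_span_singleton_twentyseven (hθ : aeval θ (csPoly 27) = 0) (h3 : finrank ℚ K = 3)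
    (I : Ideal (𝓞 K)) : ∃ β : 𝓞 K, I = span {β} := by
  haveI := isPrincipalIdealRing_ringOfIntegers_twentyseven hθ h3
  exact ⟨_, (IsPrincipalIdealRing.principal I).span_singleton_generator.symm⟩

end Field

/-! ### The model field `ℚ[X]/(f₂₇)` -/

/-- **Class number one of the trace-`27` Cappell–Shaneson field, on the model `CSField 27 = ℚ[X]/(f₂₇)`.**
[cite: KimYamada2023, §4.3–§4.4] -/
theorem isPrincipalIdealRing_ringOfIntegers_CSField_twentyseven :
    IsPrincipalIdealRing (𝓞 (CSField 27)) :=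
  isPrincipalIdealRing_ringOfIntegers_twentyseven (aeval_root_csPoly 27) (finrank_CSField 27)

/-- `d_K = 7273` for the model field `ℚ[X]/(f₂₇)`. [cite: KimYamada2023, §4.3] -/
theorem discr_CSField_twentyseven : NumberField.discr (CSField 27) = 7273 :=
  discr_eq_twentyseven (aeval_root_csPoly 27) (finrank_CSField 27)

end Literature.Topology.FourManifolds

end
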